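import Literature.NumberTheory.GaloisRepresentations.RestrictedRamificationSUnitsLayerSurjectivityTwo
import Literature.NumberTheory.GaloisRepresentations.RestrictedRamificationSUnitsLayerSupplyTwo
import Literature.NumberTheory.GaloisRepresentations.IdeleLocalInvariantsInflation
import HarnessLib

/-!
# REALIZATION SUPPLY in degree `2`: every family of local invariants `(a_v)_{v ∈ S}` with `Σ a_v = 0` is the family of
# invariants of an `S`-UNIT class in a bigger layer of `K_S` (Neukirch–Schmidt–Wingberg (8.3.11) (ii):
# `H²(G_S, 𝒪_S^×)(p) ≅ ker(⊕_{v ∈ S} ℚ_p/ℤ_p → ℚ_p/ℤ_p)` is ONTO the kernel — the finite-layer statement)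

Topic `NumberTheory/GaloisRepresentations`; namespaces `Literature.NumberTheory.GaloisRepresentations.IdeleCohomology` (§1, one
tower of number fields) and `Literature.NumberTheory.GaloisRepresentations` (§2, layers of `K_S`).  THEOREMS ONLY (no definition,
no named fact, no `sorry`, no instance).  Lane «TATE-EPC-TC» of cell `bsd-eis` (crux `GoodLatticeBDPValue`,
stmt-BirchSwinnertonDyer-19032; brick B6a, layer half, (F2d)): the LOWER-BOUND half of the exact order of the `p`-power torsion of
`H²(G_S, 𝒪_S^×)` (`= p^{k(#S−1)}` over a totally complex base), complementing the INJECTIVITY SUPPLY (F2a,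
`RestrictedRamificationSUnitsLayerInjectivityTwo`, upper bound) and built on the SURJECTIVITY SUPPLY (F2c,
`RestrictedRamificationSUnitsLayerSurjectivityTwo`).

MATHEMATICS (NSW VIII §3, proof of (8.3.11) (ii); Cassels–Fröhlich VII §11.2 (bis)).  `F` totally complex, `E/F` finite Galois
unramified outside the finite set `S` of finite places, `G = Gal(E/F)`, `n_v = [E_w : F_v]`.  Local class field theory realises
every family `(a_v)_{v ∈ S}`, `n_v a_v = 0`, as the invariants of a class `c ∈ H²(G, J_{E,S})` (the tree's
`exists_forall_mem_localInv_eq`); the invariant of its image in `H²(G, C_E) ≅ (1/n)ℤ/ℤ` is `Σ_{v ∈ S} a_v` (no archimedean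
contribution over a totally complex base: `classInvAll_map_ideleSToClass_eq_sum`), so `Σ a_v = 0` forces the image to vanish
(`classInvAll_injective`), and then — after inflation to a layer `E'` in which the idèles of `E` capitulate — `Inf c` is the image
of an `S`-UNIT class `x' ∈ H²(Gal(E'/F), 𝒪ˣ_{E',S})` (F2c), with the same invariants (`inv_v ∘ Inf = inv_v`).  Over `K_S`
(§2): for `K` totally complex, `S ⊇ S_p`, `F₀ ≤ E ⊆ K_S`, a prime power `p^k` and a family `(a_v)_{v ∈ S₀}` of `p^k`-torsion
invariants at the places `S₀` of `F₀` above `S` with `Σ a_v = 0`, the CYCLOTOMIC layer `E₁ = E(ζ_{p^M})` has `p^k ∣ n_v(E₁/F₀)` on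
`S₀` (`exists_cyclotomicLayer`), so `(a_v)` is realised in `H²(Gal(E₁/F₀), J_{E₁,S₀})`, and the capitulating layer `E' ⊇ E₁`
carries an `S`-unit class `z ∈ H²(Gal(E'/F₀), 𝒪ˣ_{E',S})` (the model `SUnits.sUnitsRep K S F₀ E'`) with invariants `(a_v)`.

* §1 `IdeleCohomology.exists_forall_localInv_eq_and_map_ideleSToClass_eq_zero` (one layer: realise `(a_v)` by a class of
  `H²(G, J_{E,S})` dying in `H²(G, C_E)`), **`IdeleCohomology.exists_forall_localInv_map_sUnitsIdeleι_eq`** (one tower with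
  capitulation: realise `(a_v)` by an `S`-unit class upstairs).
* §2 **`exists_layer_forall_localInv_eq`** — the REALIZATION SUPPLY over `K_S` in the `SUnits.sUnitsRep` / `sUnitsToIdeleS` currency.

HONEST FRAMING: finite-layer statements only (no colimit, no `G_S`-module, no `Nat.card`); proves neither (8.3.11) (ii) for `G_S` nor
any statement of a Summit; no case of BSD is advanced by this file alone; 0 cells / labels / tiers move.

## References
* J. Neukirch, A. Schmidt, K. Wingberg, *Cohomology of Number Fields*, 2nd ed. (2008), VIII §3, (8.3.11) (ii) and its proof.
  [NeukirchSchmidtWingberg2008]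
* J. W. S. Cassels, A. Fröhlich (eds.), *Algebraic Number Theory* (1967), Ch. VII (J. Tate) §7.3 Cor. 7.4 (b), §11.2 (bis).
  [CasselsFrohlichANT1967]
* D. Harari, *Galois Cohomology and Class Field Theory*, Universitext, Springer (2020), §17.4 (17.1), Prop. 15.40 (a). [Harari2020]
-/

noncomputable section

open NumberField IsDedekindDomain Field IntermediateField CategoryTheory groupCohomology
open Literature.NumberTheory.GaloisRepresentations.OpenSubgroupLayer (algOfLE isScalarTower_algOfLE)
open Literature.NumberTheory.GaloisRepresentations.LocalWeilDatum
open Literature.NumberTheory.Automorphic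

namespace Literature.NumberTheory.GaloisRepresentations

namespace IdeleCohomology

/-! ## §1. One layer / one tower over a totally complex base -/

section Tower

variable {F E E' : Type} [Field F] [NumberField F] [Field E] [NumberField E] [Field E'] [NumberField E']
  [Algebra F E] [Algebra E E'] [Algebra F E'] [IsScalarTower F E E'] [IsTotallyComplex F] [IsGalois F E] [IsGalois F E']
variable (S : Finset (HeightOneSpectrum (𝓞 F)))

omit [NumberField E'] [Algebra E E'] [Algebra F E'] [IsScalarTower F E E'] [IsGalois F E'] in
/-- **Realising `(a_v)_{v ∈ S}` with `n_v a_v = 0`, `Σ a_v = 0` by a class of `H²(G, J_{E,S})` dying in `H²(G, C_E)`** (`F` totally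
complex, `E/F` Galois unramified outside `S`): local class field theory block by block (`exists_forall_mem_localInv_eq`), then
`inv(image in C_E) = Σ_{v ∈ S} a_v = 0` (`classInvAll_map_ideleSToClass_eq_sum`) and `inv` is injective on `H²(G, C_E)`.
[cite: CasselsFrohlichANT1967, Ch. VII §7.3 Cor. 7.4 (b), §11.2 (bis)][cite: NeukirchSchmidtWingberg2008, VIII §3 (8.3.11) (ii) (proof)] -/
theorem exists_forall_localInv_eq_and_map_ideleSToClass_eq_zero
    (hS : ∀ v : HeightOneSpectrum (𝓞 F), v ∉ S → Algebra.IsUnramifiedIn (𝓞 E) v.asIdeal)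
    (a : HeightOneSpectrum (𝓞 F) → AddCircle (1 : ℚ)) (ha : ∀ v ∈ S, localDegree E v • a v = 0)
    (hsum : ∑ v ∈ S, a v = 0) :
    ∃ c : groupCohomology (ideleSRep F E S) 2,
      (∀ v ∈ S, localInv E v (groupCohomology.map (MonoidHom.id (E ≃ₐ[F] E)) (ideleSRepHom S) 2 c) = a v) ∧
        groupCohomology.map (MonoidHom.id _) (ideleSToClass S) 2 c = 0 := by
  obtain ⟨c, hc⟩ := exists_forall_mem_localInv_eq (E := E) S a ha
  refine ⟨c, hc, (classInvAll_eq_zero_iff F E _).1 ?_⟩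
  rw [classInvAll_map_ideleSToClass_eq_sum S c fun v hv => localInv_map_ideleSRepHom_eq_zero_of_notMem S hS hv c,
    Finset.sum_congr rfl hc, hsum]

/-- **REALIZATION SUPPLY, one tower (NSW (8.3.11) (ii) proof, finite layers).**  `F` totally complex, `F ⊆ E ⊆ E'` finite Galois,
`E/F` unramified outside the finite set `S` of finite places; assume CAPITULATION: the base change of every idèle of `E` lies in
`E'ˣ · J_{E',S}`.  Then every family `(a_v)_{v ∈ S}` with `n_v(E/F) · a_v = 0` and `Σ_{v ∈ S} a_v = 0` is the family of local
invariants of an `S`-UNIT class `x' ∈ H²(Gal(E'/F), 𝒪ˣ_{E',S})` (principal `S`-idèle model; invariants of its image in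
`H²(Gal(E'/F), J_{E'})`): realise `(a_v)` downstairs by `c` dying in `H²(G, C_E)` (previous theorem), lift `Inf c` to the `S`-units
upstairs (F2c `exists_map_sUnitsIdeleι_eq_ideleSInf_of_map_ideleSToClass_eq_zero`), and `inv_v(Inf c) = inv_v(c)` (`localInv_ideleInf`).
[cite: NeukirchSchmidtWingberg2008, VIII §3 (8.3.11) (ii) (proof)][cite: CasselsFrohlichANT1967, Ch. VII §11.2 (bis)] -/
theorem exists_forall_localInv_map_sUnitsIdeleι_eq
    (hS : ∀ v : HeightOneSpectrum (𝓞 F), v ∉ S → Algebra.IsUnramifiedIn (𝓞 E) v.asIdeal)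
    (hcap : ∀ x : ideleGroup E, AdeleRing.ideleBaseChange E E' x ∈ principalIdeles E' ⊔ ideleS F E' S)
    (a : HeightOneSpectrum (𝓞 F) → AddCircle (1 : ℚ)) (ha : ∀ v ∈ S, localDegree E v • a v = 0)
    (hsum : ∑ v ∈ S, a v = 0) :
    ∃ x' : groupCohomology (sUnitsIdeleRep F E' S) 2,
      ∀ v ∈ S, localInv E' v
        (groupCohomology.map (MonoidHom.id (E' ≃ₐ[F] E')) (sUnitsIdeleι S ≫ ideleSRepHom S) 2 x') = a v := by
  obtain ⟨c, hc, hc0⟩ := exists_forall_localInv_eq_and_map_ideleSToClass_eq_zero (E := E) S hS a ha hsum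
  obtain ⟨x', hx'⟩ := exists_map_sUnitsIdeleι_eq_ideleSInf_of_map_ideleSToClass_eq_zero (E' := E') S hcap c hc0
  refine ⟨x', fun v hv => ?_⟩
  rw [groupCohomology.map_id_comp]
  simp only [ModuleCat.hom_comp, LinearMap.coe_comp, Function.comp_apply]
  rw [hx', map_ideleSRepHom_ideleSInf, localInv_ideleInf]
  exact hc v hv

end Tower

end IdeleCohomology

/-! ## §2. Over `K_S`: the realization supply statement in the `SUnits.sUnitsRep` / `sUnitsToIdeleS` currency -/

variable {K : Type} [Field K] [NumberField K] (S : Set (HeightOneSpectrum (𝓞 K)))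

/-- **REALIZATION SUPPLY, degree `2` (NSW (8.3.11) (ii) at finite layers, `S`-unit model).**  `K` totally complex, `S ⊇ S_p` a set of
finite places of `K`, `F₀ ≤ E ⊆ K_S` with `E/K` finite Galois, `S₀` the finite set of places of `F₀` above `S`, `k ∈ ℕ`.  Every family
`(a_v)` of `p^k`-torsion invariants at the places of `S₀` with `Σ_{v ∈ S₀} a_v = 0` is the family of local invariants (at the places of
`S₀`) of an `S`-UNIT class `z ∈ H²(Gal(E′/F₀), 𝒪ˣ_{E′,S})` (the model `SUnits.sUnitsRep K S F₀ E′`, read in `H²(Gal(E′/F₀), J_{E′})`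
through this seat's `sUnitsToIdeleS` and the inclusion `ideleSRepHom`) for some finite Galois layer `E′ ⊇ E` inside `K_S` (all
algebras = inclusions): the cyclotomic layer `E₁ ⊇ E` with `p^k ∣ n_v(E₁/F₀)` on `S₀` (`exists_cyclotomicLayer`), the one-layer
realization over the totally complex `F₀` at `E₁` (§1), and the surjectivity supply over `K_S`
(`exists_layer_map_sUnitsToIdeleS_eq_ideleSInf_of_map_ideleSToClass_eq_zero`, capitulating layer `E′ ⊇ E₁`), the invariants being
kept by inflation (`localInv_ideleInf`).
[cite: NeukirchSchmidtWingberg2008, VIII §3 (8.3.11) (ii) (proof)][cite: CasselsFrohlichANT1967, Ch. VII §7.3 Cor. 7.4 (b), §11.2 (bis)] -/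
theorem exists_layer_forall_localInv_eq [IsTotallyComplex K] (p : ℕ) [Fact p.Prime]
    (hSp : ∀ v : HeightOneSpectrum (𝓞 K), ((p : ℕ) : 𝓞 K) ∈ v.asIdeal → v ∈ S)
    {F₀ E : IntermediateField K (AlgebraicClosure K)} [FiniteDimensional K E] [IsGalois K E] (hF : F₀ ≤ E)
    (hS : ramificationSubgroup K S ≤ galFixing K E)
    (S₀ : Finset (HeightOneSpectrum (𝓞 F₀))) (hSF : ∀ u : HeightOneSpectrum (𝓞 F₀), u ∈ S₀ ↔ u.under (𝓞 K) ∈ S) (k : ℕ)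
    (a : HeightOneSpectrum (𝓞 F₀) → AddCircle (1 : ℚ)) (ha : ∀ v ∈ S₀, p ^ k • a v = 0) (hsum : ∑ v ∈ S₀, a v = 0) :
    ∃ (E' : IntermediateField K (AlgebraicClosure K)) (_ : FiniteDimensional K E') (_ : IsGalois K E') (hEE' : E ≤ E')
      (_ : ramificationSubgroup K S ≤ galFixing K E'),
      letI := algOfLE (hF.trans hEE')
      haveI : FiniteDimensional K F₀ :=
        FiniteDimensional.of_injective (IntermediateField.inclusion hF).toLinearMap (IntermediateField.inclusion hF).injective
      haveI : NumberField F₀ := NumberField.of_module_finite K F₀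
      haveI : NumberField E' := NumberField.of_module_finite K E'
      haveI := isScalarTower_algOfLE (K := K) (hF.trans hEE')
      haveI : IsGalois F₀ E' := IsGalois.tower_top_of_isGalois K F₀ E'
      ∃ z : groupCohomology (SUnits.sUnitsRep K S F₀ E') 2,
        ∀ v ∈ S₀, IdeleCohomology.localInv E' v
          (groupCohomology.map (MonoidHom.id (E' ≃ₐ[F₀] E')) (A := SUnits.sUnitsRep K S F₀ E')
            (B := IdeleClassGroup.ideleRep F₀ E')
            (IdeleCohomology.sUnitsToIdeleS (K := K) (F := F₀) (E := E') S S₀ hSF ≫ IdeleCohomology.ideleSRepHom S₀) 2 z) =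
          a v := by
  classical
  -- the base `F₀`: finite over `K`, a totally complex number field
  letI := algOfLE hF
  haveI := isScalarTower_algOfLE (K := K) hF
  haveI : FiniteDimensional K F₀ :=
    FiniteDimensional.of_injective (IntermediateField.inclusion hF).toLinearMap (IntermediateField.inclusion hF).injective
  haveI : NumberField F₀ := NumberField.of_module_finite K F₀
  haveI : NumberField E := NumberField.of_module_finite K E
  haveI : IsTotallyComplex F₀ := isTotallyComplex_of_algebra K F₀
  -- the cyclotomic layer `E ≤ E₁ ⊆ K_S` with `p ^ k ∣ n_v(E₁/F₀)` on `S₀`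
  obtain ⟨E₁, h₁, hfin₁, hgal₁, hS₁, hdeg⟩ := exists_cyclotomicLayer S p hSp hF hS S₀ k
  letI := algOfLE h₁
  letI := algOfLE (hF.trans h₁)
  haveI : NumberField E₁ := NumberField.of_module_finite K E₁
  haveI := isScalarTower_algOfLE (K := K) h₁
  haveI := isScalarTower_algOfLE (K := K) (hF.trans h₁)
  haveI : IsScalarTower F₀ E E₁ := IsScalarTower.of_algebraMap_eq fun _ => rfl
  haveI : IsGalois F₀ E := IsGalois.tower_top_of_isGalois K F₀ E
  haveI : IsGalois F₀ E₁ := IsGalois.tower_top_of_isGalois K F₀ E₁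
  -- `E₁/F₀` is unramified outside `S₀`, and `n_v(E₁/F₀) • a_v = 0` on `S₀`
  have hunr₁ : ∀ v : HeightOneSpectrum (𝓞 F₀), v ∉ S₀ → Algebra.IsUnramifiedIn (𝓞 E₁) v.asIdeal :=
    fun v hv => isUnramifiedIn_of_le_of_ramificationSubgroup_le_galFixing S (hF.trans h₁) hS₁ v fun h => hv ((hSF v).2 h)
  have ha₁ : ∀ v ∈ S₀, IdeleCohomology.localDegree E₁ v • a v = 0 := by
    intro v hv
    obtain ⟨m, hm⟩ := Nat.dvd_trans (Dvd.intro _ rfl) (hdeg v hv)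
    rw [hm, mul_comm, mul_smul, ha v hv, smul_zero]
  -- realise `(a_v)` at the layer `E₁` by a class of `H²(Gal(E₁/F₀), J_{E₁,S₀})` dying in `H²(Gal(E₁/F₀), C_{E₁})`
  obtain ⟨c, hc, hc0⟩ :=
    IdeleCohomology.exists_forall_localInv_eq_and_map_ideleSToClass_eq_zero (F := F₀) (E := E₁) S₀ hunr₁ a ha₁ hsum
  -- the surjectivity supply over `K_S`: an `S`-unit class `z` at a capitulating layer `E' ⊇ E₁` mapping to `Inf c`
  obtain ⟨E', hfin', hgal', h₁', hS', z, hz⟩ :=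
    exists_layer_map_sUnitsToIdeleS_eq_ideleSInf_of_map_ideleSToClass_eq_zero S (hF.trans h₁) hS₁ S₀ hSF c hc0
  refine ⟨E', hfin', hgal', h₁.trans h₁', hS', ?_⟩
  letI : Algebra E₁ E' := algOfLE h₁'
  letI : Algebra F₀ E' := algOfLE (hF.trans (h₁.trans h₁'))
  haveI : NumberField E' := NumberField.of_module_finite K E'
  haveI := isScalarTower_algOfLE (K := K) h₁'
  haveI := isScalarTower_algOfLE (K := K) (hF.trans (h₁.trans h₁'))
  haveI : IsScalarTower F₀ E₁ E' := IsScalarTower.of_algebraMap_eq fun _ => rfl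
  haveI : IsGalois F₀ E' := IsGalois.tower_top_of_isGalois K F₀ E'
  refine ⟨z, fun v hv => ?_⟩
  -- the image of `z` in `H²(Gal(E'/F₀), J_{E'})` is `Inf c` read in `J_{E'}`
  have hz' : groupCohomology.map (MonoidHom.id (E' ≃ₐ[F₀] E')) (A := SUnits.sUnitsRep K S F₀ E')
        (B := IdeleClassGroup.ideleRep F₀ E')
        (IdeleCohomology.sUnitsToIdeleS (K := K) (F := F₀) (E := E') S S₀ hSF ≫ IdeleCohomology.ideleSRepHom S₀) 2 z =
      groupCohomology.map (MonoidHom.id _) (IdeleCohomology.ideleSRepHom S₀) 2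
        (IdeleCohomology.ideleSInf F₀ E₁ E' S₀ 2 c) := by
    rw [groupCohomology.map_id_comp]
    simp only [ModuleCat.hom_comp, LinearMap.coe_comp, Function.comp_apply]
    rw [← hz]
  -- `inv_v(Inf c) = inv_v(c) = a_v`
  have key : IdeleCohomology.localInv E' v
      (groupCohomology.map (MonoidHom.id (E' ≃ₐ[F₀] E')) (A := SUnits.sUnitsRep K S F₀ E')
        (B := IdeleClassGroup.ideleRep F₀ E')
        (IdeleCohomology.sUnitsToIdeleS (K := K) (F := F₀) (E := E') S S₀ hSF ≫ IdeleCohomology.ideleSRepHom S₀) 2 z) =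
      a v := by
    rw [hz', IdeleCohomology.map_ideleSRepHom_ideleSInf, IdeleCohomology.localInv_ideleInf]
    exact hc v hv
  -- (the statement's inlined instances vs. the local ones: close by congruence, not by one monolithic `rfl`)
  convert key using 4

end Literature.NumberTheory.GaloisRepresentations

end
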